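import Literature.Geometry.Riemannian.GreatSphereFibrationChartInv
import HarnessLib

/-!
# The transition map between the two affine charts of the base (Hähl 1987, 2.5/2.9/4.3)

Fifth file of the proof programme for the corrected form of
`Literature.Geometry.Riemannian.Hahl1987_greatSphereFibration_base_sphere` (H. Hähl, Results
Math. 12 (1987) 99–118, Prop. 4.7). Fix a great-sphere submersion `p` (`IsGreatSphereSubmersion`),
two points `x∞, e` of the sphere in different fibres, the fibre subspaces `U∞ = V_{x∞}`,
`U₀ = V_e` (a complementary pair of the spread, Hähl's coordinate axes) with frames
`J∞ : ℝᵏ ≃ U∞`, `J₀ : ℝᵏ ≃ U₀`, and the two affine charts of the base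
`Φ = baseChart p x∞ e J∞ : ℝᵏ ≅ M ∖ {∞}` (`∞ = p x∞`) and `Ψ = baseChart p x∞ x∞ J₀ : ℝᵏ ≅ M ∖ {0}`
(`0 = p e`) — Hähl's `ψ_∞`, `ψ₀` of 2.9. This file studies the coordinate expression of the
quasifield division underlying their transition map (Hähl 2.5 (ii): "the map `(x, y) ↦ y/x` is
differentiable"; 4.3: `B(π) = ℝⁿ ∪_ψ̃ ℝⁿ`):

* `transΘ b c = Φ⁻¹ (𝒫 (J₀ b + J∞ c))` — the `U∞`-coordinate of the fibre through the point with
  `U₀`-component `b ≠ 0` and `U∞`-component `c` (Hähl's `y/x` with `x = J₀ b`, `y = J∞ c`, read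
  through the chart centred at `U₀ = U_0`). It is `C^∞` on `{b ≠ 0}` (`contDiffAt_transΘ`),
  vanishes at `c = 0` (`transΘ_zero`), and `c ↦ transΘ b c` has the smooth left inverse
  `c' ↦ spreadCoord J∞ (J₀ b) (Φ c')` (`spreadCoord_baseChart_transΘ`; Hähl: `x\(y/x ∘ x) …`, the maps
  `a ↦ a ∘ x` and `y ↦ y/x` are mutually inverse), so **its differential at `0` is injective**
  (`fderiv_transΘ_injective`) — the tree's form of Hähl's Lemma 3.1 (the infinitesimal algebra
  has no zero divisors).
* `transG (b, u) = transΘ b (u • c∞) = Φ⁻¹ (𝒫 (J₀ b + u x∞))`, the restriction to the line through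
  the base point `x∞` of `U∞`: for `u > 0` this is `Φ⁻¹ (Ψ (b/u))`, i.e. the transition map
  `Φ⁻¹ ∘ Ψ` along the ray of `b`, reparametrised by `u = 1/r` so as to be smooth through `u = 0`
  (`contDiffAt_transG`, `transG_zero`, `transG_smul`); its `u`-derivative `transD` is jointly
  continuous on `{b ≠ 0}` (`continuousOn_transD`) and **non-zero at `u = 0`** (`transD_ne_zero`).

Everything is proved; the definitions are explicit coordinate expressions. No named facts.

## References

* [Hahl1987] H. Hähl, Results Math. 12 (1987) 99–118 — 2.5, 2.9, 3.1, 4.3.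
-/

noncomputable section

open Set Function Module Submodule Metric
open scoped Manifold ContDiff Topology

namespace Literature.Geometry.Riemannian

variable {E : Type*} [NormedAddCommGroup E] [InnerProductSpace ℝ E] {M : Type*} {k : ℕ}
  {p : sphere (0 : E) 1 → M} {xinf e : sphere (0 : E) 1}
  (Jinf : EuclideanSpace ℝ (Fin k) ≃L[ℝ] fibreSpan p xinf)
  (J₀ : EuclideanSpace ℝ (Fin k) ≃L[ℝ] fibreSpan p e)

/-! ### The two-variable division map `Θ` -/

/-- **The division map in coordinates**: `transΘ b c = spreadCoord J∞ e (𝒫 (J₀ b + J∞ c))`, the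
`U∞`-coordinate (in the chart centred at the fibre of `e`) of the fibre through `J₀ b + J∞ c`
(Hähl's `y/x`, 2.2/2.5, with `x = J₀ b ∈ U₀`, `y = J∞ c ∈ U∞`). [cite: Hahl1987, 2.5] -/
def transΘ (Jinf : EuclideanSpace ℝ (Fin k) ≃L[ℝ] fibreSpan p xinf)
    (J₀ : EuclideanSpace ℝ (Fin k) ≃L[ℝ] fibreSpan p e) (b c : EuclideanSpace ℝ (Fin k)) :
    EuclideanSpace ℝ (Fin k) :=
  spreadCoord Jinf (e : E) (coneExtension p xinf ((J₀ b : E) + (Jinf c : E)))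

/-- Unfolding. [folklore] -/
theorem transΘ_apply (b c : EuclideanSpace ℝ (Fin k)) :
    transΘ Jinf J₀ b c = spreadCoord Jinf (e : E) (coneExtension p xinf ((J₀ b : E) + (Jinf c : E))) :=
  rfl

/-- The coordinate of the base point `x∞` in the frame `J∞`. [folklore] -/
def cinf (Jinf : EuclideanSpace ℝ (Fin k) ≃L[ℝ] fibreSpan p xinf) : EuclideanSpace ℝ (Fin k) :=
  Jinf.symm ⟨xinf, self_mem_fibreSpan xinf⟩

/-- `J∞ c∞ = x∞`. [folklore] -/
@[simp]
theorem frame_cinf : ((Jinf (cinf Jinf) : fibreSpan p xinf) : E) = xinf := by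
  rw [cinf, ContinuousLinearEquiv.apply_symm_apply]

/-- `c∞ ≠ 0`. [folklore] -/
theorem cinf_ne_zero : cinf Jinf ≠ 0 := by
  intro h
  have := frame_cinf Jinf
  rw [h, map_zero, ZeroMemClass.coe_zero] at this
  exact ne_zero_of_mem_unit_sphere xinf this.symm

/-- **The transition map along a ray, reparametrised**: `transG (b, u) = transΘ b (u • c∞)
= spreadCoord J∞ e (𝒫 (J₀ b + u • x∞))`; for `u > 0`, `𝒫 (J₀ b + u x∞) = 𝒫 (x∞ + J₀ (b/u)) = Ψ (b/u)`
so this is `Φ⁻¹ (Ψ (b/u))` (Hähl 4.3: the gluing map `ψ̃` of `B(π) = ℝⁿ ∪_ψ̃ ℝⁿ`, along the ray of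
`b` with parameter `u = 1/r`). [cite: Hahl1987, 4.3] -/
def transG (Jinf : EuclideanSpace ℝ (Fin k) ≃L[ℝ] fibreSpan p xinf)
    (J₀ : EuclideanSpace ℝ (Fin k) ≃L[ℝ] fibreSpan p e) (q : EuclideanSpace ℝ (Fin k) × ℝ) :
    EuclideanSpace ℝ (Fin k) :=
  transΘ Jinf J₀ q.1 (q.2 • cinf Jinf)

/-- Unfolding: `transG (b, u) = spreadCoord J∞ e (𝒫 (J₀ b + u • x∞))`. [folklore] -/
theorem transG_apply (b : EuclideanSpace ℝ (Fin k)) (u : ℝ) :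
    transG Jinf J₀ (b, u) = spreadCoord Jinf (e : E) (coneExtension p xinf ((J₀ b : E) + u • (xinf : E))) := by
  rw [transG, transΘ_apply, map_smul, Submodule.coe_smul, frame_cinf]

section WithHyp

variable {d : ℕ} [Fact (finrank ℝ E = d + 1)] [TopologicalSpace M]
  [ChartedSpace (EuclideanSpace ℝ (Fin k)) M] (hp : IsGreatSphereSubmersion d k p)
  (he : p e ≠ p xinf)
include hp he

/-- `e ∉ U∞`. [folklore] -/
theorem coe_notMem_fibreSpan_inf : (e : E) ∉ fibreSpan p xinf := by
  rw [mem_fibreSpan_iff hp.exists_fibre]; exact he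

/-- `x∞ ∉ U₀`. [folklore] -/
theorem coe_inf_notMem_fibreSpan : (xinf : E) ∉ fibreSpan p e := by
  rw [mem_fibreSpan_iff hp.exists_fibre]; exact Ne.symm he

/-- `U₀ ∩ U∞ = 0`. [cite: Hahl1987, 2.1] -/
theorem disjoint_fibreSpan_zero_inf : Disjoint (fibreSpan p e) (fibreSpan p xinf) :=
  disjoint_fibreSpan hp.exists_fibre he

/-- A point with non-zero `U₀`-component does not lie in `U∞`: `J₀ b + y ∉ U∞` for `b ≠ 0`,
`y ∈ U∞`. [cite: Hahl1987, 2.1] -/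
theorem frame_add_notMem {b : EuclideanSpace ℝ (Fin k)} (hb : b ≠ 0) {y : E}
    (hy : y ∈ fibreSpan p xinf) : (J₀ b : E) + y ∉ fibreSpan p xinf := by
  intro h
  have h1 : ((J₀ b : fibreSpan p e) : E) ∈ fibreSpan p xinf := by simpa using sub_mem h hy
  have h0 := Submodule.disjoint_def.1 (disjoint_fibreSpan_zero_inf hp he) _ (J₀ b).2 h1
  have h2 : J₀ b = 0 := @Subtype.ext _ _ (J₀ b) 0 h0
  exact hb (J₀.injective (h2.trans (map_zero J₀).symm))

/-- In particular `J₀ b ∉ U∞` for `b ≠ 0`. [folklore] -/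
theorem frame_notMem {b : EuclideanSpace ℝ (Fin k)} (hb : b ≠ 0) :
    ((J₀ b : fibreSpan p e) : E) ∉ fibreSpan p xinf := by
  simpa using frame_add_notMem J₀ hp he hb (zero_mem _)

/-- **`Θ` is smooth where `b ≠ 0`** (as a map of `(b, c)`): composition of the smooth
coordinate change `v ↦ spreadCoord J∞ e (𝒫 v)` at `v = J₀ b + J∞ c ∉ U∞` with a linear map.
Hähl 2.5 (ii). [cite: Hahl1987, 2.5] -/
theorem contDiffAt_transΘ [IsManifold (𝓡 k) ∞ M] {b : EuclideanSpace ℝ (Fin k)} (hb : b ≠ 0)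
    (c : EuclideanSpace ℝ (Fin k)) :
    ContDiffAt ℝ ∞ (fun q : EuclideanSpace ℝ (Fin k) × EuclideanSpace ℝ (Fin k) =>
      transΘ Jinf J₀ q.1 q.2) (b, c) := by
  have hlin : ContDiff ℝ ∞ (fun q : EuclideanSpace ℝ (Fin k) × EuclideanSpace ℝ (Fin k) =>
      ((J₀ q.1 : fibreSpan p e) : E) + ((Jinf q.2 : fibreSpan p xinf) : E)) :=
    (((fibreSpan p e).subtypeL.comp J₀.toContinuousLinearMap).contDiff.comp contDiff_fst).add
      (((fibreSpan p xinf).subtypeL.comp Jinf.toContinuousLinearMap).contDiff.comp contDiff_snd)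
  have hv : ((J₀ b : fibreSpan p e) : E) + ((Jinf c : fibreSpan p xinf) : E) ∉ fibreSpan p xinf :=
    frame_add_notMem J₀ hp he hb (Jinf c).2
  have h := (contDiffAt_spreadCoord_coneExtension Jinf hp (coe_notMem_fibreSpan_inf hp he) hv
    (x₀ := xinf)).comp (b, c) hlin.contDiffAt
  exact h

/-- … hence `c ↦ Θ b c` is smooth for `b ≠ 0`. [cite: Hahl1987, 2.5] -/
theorem contDiffAt_transΘ_right [IsManifold (𝓡 k) ∞ M] {b : EuclideanSpace ℝ (Fin k)} (hb : b ≠ 0)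
    (c : EuclideanSpace ℝ (Fin k)) : ContDiffAt ℝ ∞ (transΘ Jinf J₀ b) c :=
  (contDiffAt_transΘ Jinf J₀ hp he hb c).comp c (contDiffAt_const.prodMk contDiffAt_id)

/-- **`Θ b 0 = 0`** (`b ≠ 0`): the fibre through `J₀ b ∈ U₀` is `U₀` itself, the centre of the chart
`Φ` (Hähl: `0/x = 0`). [cite: Hahl1987, 2.2] -/
theorem transΘ_zero {b : EuclideanSpace ℝ (Fin k)} (hb : b ≠ 0) : transΘ Jinf J₀ b 0 = 0 := by
  rw [transΘ_apply, map_zero, ZeroMemClass.coe_zero, add_zero]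
  have hb0 : ((J₀ b : fibreSpan p e) : E) ≠ 0 := fun h => frame_notMem J₀ hp he hb (h ▸ zero_mem _)
  rw [coneExtension_eq_of_mem hp.exists_fibre hb0 (J₀ b).2,
    spreadCoord_eq_zero_iff Jinf hp he, baseSpan_apply]
  exact self_mem_fibreSpan e

/-- The value `𝒫 (J₀ b + J∞ c)` is recovered from `Θ b c` by the chart `Φ`:
`Φ (Θ b c) = 𝒫 (J₀ b + J∞ c)`. [cite: Hahl1987, 2.5] -/
theorem baseChart_transΘ {b : EuclideanSpace ℝ (Fin k)} (hb : b ≠ 0) (c : EuclideanSpace ℝ (Fin k)) :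
    baseChart p xinf (e : E) Jinf (transΘ Jinf J₀ b c) =
      coneExtension p xinf (((J₀ b : fibreSpan p e) : E) + ((Jinf c : fibreSpan p xinf) : E)) := by
  rw [transΘ_apply]
  refine baseChart_spreadCoord Jinf hp (coe_notMem_fibreSpan_inf hp he) ?_
  have hv := frame_add_notMem J₀ hp he hb (Jinf c).2
  have hv0 : ((J₀ b : fibreSpan p e) : E) + ((Jinf c : fibreSpan p xinf) : E) ≠ 0 :=
    fun h => hv (h ▸ zero_mem _)
  rw [← coneExtension_coe (p := p) (x₀ := xinf) xinf, Ne,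
    coneExtension_eq_iff hp.exists_fibre _ hv0, unitVec_coe]
  exact hv

/-- **Left inverse** (Hähl: `a ↦ a ∘ x` inverts `y ↦ y/x`): reading `Φ (Θ b c) = 𝒫 (J₀ b + J∞ c)`
in the chart with the SAME coordinate space `U∞` but base vector `J₀ b` returns `c`:
`spreadCoord J∞ (J₀ b) (Φ (Θ b c)) = c`. [cite: Hahl1987, 2.2 and 2.5] -/
theorem spreadCoord_baseChart_transΘ {b : EuclideanSpace ℝ (Fin k)} (hb : b ≠ 0)
    (c : EuclideanSpace ℝ (Fin k)) :
    spreadCoord Jinf ((J₀ b : fibreSpan p e) : E) (baseChart p xinf (e : E) Jinf (transΘ Jinf J₀ b c)) = c := by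
  rw [baseChart_transΘ Jinf J₀ hp he hb c, ← baseChart_apply (x₀ := xinf) Jinf,
    spreadCoord_baseChart Jinf hp (frame_notMem J₀ hp he hb)]

variable [IsManifold (𝓡 k) ∞ M]

/-- **The differential of `c ↦ Θ b c` at `0` is injective** (`b ≠ 0`): `Θ b` has the smooth left
inverse `g = spreadCoord J∞ (J₀ b) ∘ Φ`, so `dg ∘ d(Θ b)_0 = id`. This is the tree's form of Hähl's
Lemma 3.1 (no zero divisors in the infinitesimal division algebra: the derivative of the bijection
`a ↦ a ∘ x`, `x ≠ 0`, is invertible). [cite: Hahl1987, 3.1] -/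
theorem fderiv_transΘ_injective {b : EuclideanSpace ℝ (Fin k)} (hb : b ≠ 0) :
    Injective (fderiv ℝ (transΘ Jinf J₀ b) 0) := by
  set g : EuclideanSpace ℝ (Fin k) → EuclideanSpace ℝ (Fin k) := fun c' =>
    spreadCoord Jinf ((J₀ b : fibreSpan p e) : E) (coneExtension p xinf ((e : E) + (Jinf c' : E))) with hg
  have hleft : g ∘ transΘ Jinf J₀ b = id := by
    funext c
    simp only [comp_apply, id_eq, hg]
    rw [← baseChart_apply (x₀ := xinf) Jinf]
    exact spreadCoord_baseChart_transΘ Jinf J₀ hp he hb c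
  -- `g` is smooth at `Θ b 0`
  have hge : ∀ c', ContDiffAt ℝ ∞ g c' := fun c' => by
    have hlin : ContDiff ℝ ∞ (fun c' : EuclideanSpace ℝ (Fin k) =>
        (e : E) + ((Jinf c' : fibreSpan p xinf) : E)) :=
      contDiff_const.add (((fibreSpan p xinf).subtypeL.comp Jinf.toContinuousLinearMap).contDiff)
    exact (contDiffAt_spreadCoord_coneExtension Jinf hp (frame_notMem J₀ hp he hb)
      (add_frame_notMem Jinf (coe_notMem_fibreSpan_inf hp he) c') (x₀ := xinf)).comp c' hlin.contDiffAt
  have h1 : DifferentiableAt ℝ g (transΘ Jinf J₀ b 0) := (hge _).differentiableAt (by simp)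
  have h2 : DifferentiableAt ℝ (transΘ Jinf J₀ b) 0 :=
    (contDiffAt_transΘ_right Jinf J₀ hp he hb 0).differentiableAt (by simp)
  have hcomp := fderiv_comp (0 : EuclideanSpace ℝ (Fin k)) h1 h2
  rw [hleft, fderiv_id] at hcomp
  intro v v' h
  have := congrArg (fun f : EuclideanSpace ℝ (Fin k) →L[ℝ] EuclideanSpace ℝ (Fin k) => f v) hcomp
  have h' := congrArg (fun f : EuclideanSpace ℝ (Fin k) →L[ℝ] EuclideanSpace ℝ (Fin k) => f v') hcomp
  simp only [ContinuousLinearMap.coe_id', id_eq, ContinuousLinearMap.coe_comp, comp_apply] at this h'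
  rw [this, h', h]

/-! ### The transition map along rays -/

omit [IsManifold (𝓡 k) ∞ M] in
/-- **`transG (b, 0) = 0`** for `b ≠ 0`. [cite: Hahl1987, 4.3] -/
theorem transG_zero {b : EuclideanSpace ℝ (Fin k)} (hb : b ≠ 0) : transG Jinf J₀ (b, 0) = 0 := by
  rw [transG, zero_smul, transΘ_zero Jinf J₀ hp he hb]

omit [IsManifold (𝓡 k) ∞ M] he in
/-- **Homogeneity**: `transG (s • b, s u) = transG (b, u)` for `s ≠ 0` (`𝒫` is constant on
punctured lines). [cite: Hahl1987, 4.3] -/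
theorem transG_smul {s : ℝ} (hs : s ≠ 0) (b : EuclideanSpace ℝ (Fin k)) (u : ℝ) :
    transG Jinf J₀ (s • b, s * u) = transG Jinf J₀ (b, u) := by
  rw [transG_apply, transG_apply, map_smul, Submodule.coe_smul, mul_smul, ← smul_add,
    coneExtension_smul_of_ne_zero hp.exists_fibre hs]

/-- **`transG` is smooth on `{b ≠ 0}`** (all `u`, including `u ≤ 0`). [cite: Hahl1987, 2.5 and 4.3] -/
theorem contDiffAt_transG {b : EuclideanSpace ℝ (Fin k)} (hb : b ≠ 0) (u : ℝ) :
    ContDiffAt ℝ ∞ (transG Jinf J₀) (b, u) := by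
  have h : ContDiff ℝ ∞ (fun q : EuclideanSpace ℝ (Fin k) × ℝ => (q.1, q.2 • cinf Jinf)) :=
    contDiff_fst.prodMk (contDiff_snd.smul contDiff_const)
  have h2 := (contDiffAt_transΘ Jinf J₀ hp he hb (u • cinf Jinf)).comp (b, u) h.contDiffAt
  exact h2

/-- Smoothness on the open set `{b ≠ 0}`. [cite: Hahl1987, 2.5 and 4.3] -/
theorem contDiffOn_transG :
    ContDiffOn ℝ ∞ (transG Jinf J₀) {q : EuclideanSpace ℝ (Fin k) × ℝ | q.1 ≠ 0} := fun q hq =>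
  (contDiffAt_transG Jinf J₀ hp he hq q.2).contDiffWithinAt

omit [Fact (finrank ℝ E = d + 1)] [TopologicalSpace M] [ChartedSpace (EuclideanSpace ℝ (Fin k)) M]
  [IsManifold (𝓡 k) ∞ M] hp he in
/-- The set `{b ≠ 0}` of the parameter space is open. [folklore] -/
theorem isOpen_fst_ne_zero : IsOpen {q : EuclideanSpace ℝ (Fin k) × ℝ | q.1 ≠ 0} :=
  isOpen_ne.preimage continuous_fst

/-- **The `u`-derivative** of the transition map along rays: `transD q = d(transG)_q (0, 1)`.
[cite: Hahl1987, 4.5] -/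
def transD (Jinf : EuclideanSpace ℝ (Fin k) ≃L[ℝ] fibreSpan p xinf)
    (J₀ : EuclideanSpace ℝ (Fin k) ≃L[ℝ] fibreSpan p e) (q : EuclideanSpace ℝ (Fin k) × ℝ) :
    EuclideanSpace ℝ (Fin k) :=
  fderiv ℝ (transG Jinf J₀) q (0, 1)

/-- `transD` is the derivative of `u ↦ transG (b, u)`. [cite: Hahl1987, 4.5] -/
theorem hasDerivAt_transG {b : EuclideanSpace ℝ (Fin k)} (hb : b ≠ 0) (u : ℝ) :
    HasDerivAt (fun s : ℝ => transG Jinf J₀ (b, s)) (transD Jinf J₀ (b, u)) u := by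
  have hd : HasFDerivAt (transG Jinf J₀) (fderiv ℝ (transG Jinf J₀) (b, u)) (b, u) :=
    ((contDiffAt_transG Jinf J₀ hp he hb u).differentiableAt (by simp)).hasFDerivAt
  have hl : HasDerivAt (fun s : ℝ => ((b, s) : EuclideanSpace ℝ (Fin k) × ℝ))
      ((0 : EuclideanSpace ℝ (Fin k)), (1 : ℝ)) u :=
    (hasDerivAt_const u b).prodMk (hasDerivAt_id u)
  exact hd.comp_hasDerivAt u hl

/-- **`transD` is jointly continuous on `{b ≠ 0}`** (continuity of the Fréchet derivative of a
`C^∞` map on an open set). [cite: Hahl1987, 4.5] -/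
theorem continuousOn_transD :
    ContinuousOn (transD Jinf J₀) {q : EuclideanSpace ℝ (Fin k) × ℝ | q.1 ≠ 0} := by
  have h := (contDiffOn_transG Jinf J₀ hp he).continuousOn_fderiv_of_isOpen isOpen_fst_ne_zero
    (by simp)
  exact (ContinuousLinearMap.apply ℝ (EuclideanSpace ℝ (Fin k)) ((0 : EuclideanSpace ℝ (Fin k)),
    (1 : ℝ))).continuous.comp_continuousOn h

/-- `transD` is continuous at every `(b, u)` with `b ≠ 0`. [cite: Hahl1987, 4.5] -/
theorem continuousAt_transD {b : EuclideanSpace ℝ (Fin k)} (hb : b ≠ 0) (u : ℝ) :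
    ContinuousAt (transD Jinf J₀) (b, u) :=
  (continuousOn_transD Jinf J₀ hp he).continuousAt (isOpen_fst_ne_zero.mem_nhds hb)

/-- **The `u`-derivative at `u = 0` does not vanish** (`b ≠ 0`): it is `d(Θ b)_0 c∞` with
`d(Θ b)_0` injective and `c∞ ≠ 0`. This is the transversality that makes the gluing map of the
base isotopic to a conical map (Hähl 4.5: `ψ_t (b) = t ψ̃ (t b)` is differentiable at `t = 0` with
`ψ₀ = ψ`, the inversion of the infinitesimal division algebra, a diffeomorphism). [cite: Hahl1987, 3.1 and 4.5] -/
theorem transD_ne_zero {b : EuclideanSpace ℝ (Fin k)} (hb : b ≠ 0) : transD Jinf J₀ (b, 0) ≠ 0 := by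
  -- `transD (b, 0)` is the derivative at `0` of `s ↦ Θ b (s • c∞)`
  have h1 := hasDerivAt_transG Jinf J₀ hp he hb 0
  have h2 : HasDerivAt (fun s : ℝ => transΘ Jinf J₀ b (s • cinf Jinf))
      (fderiv ℝ (transΘ Jinf J₀ b) 0 (cinf Jinf)) 0 := by
    have hΘ : HasFDerivAt (transΘ Jinf J₀ b) (fderiv ℝ (transΘ Jinf J₀ b) 0) ((0 : ℝ) • cinf Jinf) := by
      rw [zero_smul]
      exact ((contDiffAt_transΘ_right Jinf J₀ hp he hb 0).differentiableAt (by simp)).hasFDerivAt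
    have hl : HasDerivAt (fun s : ℝ => s • cinf Jinf) (cinf Jinf) 0 := by
      simpa using (hasDerivAt_id (0 : ℝ)).smul_const (cinf Jinf)
    exact hΘ.comp_hasDerivAt 0 hl
  have heq : transD Jinf J₀ (b, 0) = fderiv ℝ (transΘ Jinf J₀ b) 0 (cinf Jinf) := h1.unique h2
  rw [heq]
  intro h0
  have := fderiv_transΘ_injective Jinf J₀ hp he hb (a₁ := cinf Jinf) (a₂ := 0) (by rw [h0, map_zero])
  exact cinf_ne_zero Jinf this

end WithHyp

end Literature.Geometry.Riemannian

end
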